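import Literature.AlgebraicGeometry.ShimuraVarieties.UnitaryShimuraCanonicalModelComplexFibre
import HarnessLib

/-!
# The complex shadow of Deligne's canonical-model record: the COMPLEX RECORD of `Sh_K(U(H), 𝔹²)`

Topic `AlgebraicGeometry/ShimuraVarieties`; namespace `Literature.AlgebraicGeometry.ShimuraVarieties`, grouping
sub-namespace `UnitaryCanonicalModel` (the object of `UnitaryShimuraCanonicalModel`).  ONE hypothesis-free
structure (`UnitaryCanonicalModel.ComplexRecord`), ONE definition with body (`Record.complexRecord`, the shadow of a
record along `τ`) and bookkeeping theorems.  No named fact; nothing is asserted; T5: n/a (no theorem has two `Prop`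
hypothesis binders).

WHAT IT IS FOR.  The record `UnitaryCanonicalModel.Record L H τ T hT K` of `UnitaryShimuraCanonicalModel` (the
carrier of the named fact `exists_recordSystem`, [Deligne1979ShimuraVarieties] 2.2.5 + Cor. 2.7.21 read on the
tree's carriers) has two kinds of clauses:

* COMPLEX-GEOMETRIC clauses, which only see the complex fibre `M_τ = M ⊗_{L,τ} ℂ` and its complex points:
  (F1 read over `ℂ`) `M_τ` smooth of relative dimension `2` and projective over `ℂ`; (F2a) `pts : M_τ(ℂ) ≃ₜ Sh_K(ℂ)`;
  (F2b) `hol` — `z ↦ [z, aK]` is holomorphic in the algebraic coordinates of `M_τ`; (F2c) `pieces` — `M_τ` is the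
  colimit cofan, indexed by `Ξ_K`, of compact ball quotients of the tree's kind by the NATURAL levels
  `τ(Γ_H(g_qKg_q⁻¹))`.  These are [Deligne1979ShimuraVarieties] 2.1.2 («`_K M_ℂ(G,X)` … is a disjoint sum, indexed by
  `G(ℚ)\G(𝔸^f)/K`, of the quotients `Γ_g\X⁺` … [Baily–Borel] … algebraic structure … unique [Borel]») and
  [Milne2005ShimuraVarieties] Lemma 5.13 — statements about the COMPLEX variety `M_ℂ`;
* ARITHMETIC clauses: (F1) the model lives over `L` (along `τ`, i.e. over the reflex field `τ(L)`), and (F3) `recip`,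
  Shimura reciprocity (62) at the diagonal special pairs — [Deligne1979ShimuraVarieties] 2.2.5 proper («a form over
  `E(G,X)` of `M_ℂ(G,X)` … such that … the Galois group acts through 2.2.4»).

`ComplexRecord L H τ T hT K` is the structure of the first kind VERBATIM, for an arbitrary complex scheme `Mc` in
place of `M_τ` (so `ComplexPoints Mc` in place of `ComplexPoints M_τ`, and `pts.symm` in place of
`AlgPoints.baseChangeEquiv τ M ∘ pts.symm`).  `Record.complexRecord` sends a record to its shadow
(`Mc := (Motives.baseChangeHom τ).obj R.M`, (F1) by base change — the tree's `Record.smooth_complexFibre`,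
`Record.projective_complexFibre`; (F2a) composed with the homeomorphism `M(ℂ)_{along τ} = M_τ(ℂ)`,
`Record.exists_homeomorph_complexFibre`; (F2b), (F2c) unchanged), so every inhabitant of `Record` gives one of
`ComplexRecord`.  The converse direction — an inhabitant of `ComplexRecord` at EVERY datum `(L, H, τ, T, hT, K)` with
`H` definite off `τ`, anisotropic and `K` compact open with torsion-free conjugate arithmetic levels, assembled from
the tree's compact ball quotients (`PicardCM.BallQuotientUniformised`, a theorem of the tree on the Summits side) — is
the Summits-side kernel witness `Summit.HodgeConjecture.CorCM.HComp.nonempty_complexRecord` (cell pub-hodgecm2): the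
complex-geometric clauses of Deligne's record are jointly satisfiable by CONSTRUCTION, and what the named fact
`exists_recordSystem` asserts beyond them is exactly the arithmetic part (the `L`-form and (62)).

Use (cells pub-hodgecm / pub-hodgecm2; red-team item «T5 witness for `exists_recordSystem` v5»): consistency / non-vacuity
evidence for the record; nothing here is a Hodge class, a period or an `L`-value; HC_CM is not mentioned and not implied;
no binder of any cell is discharged here.

## References
* [Deligne1979ShimuraVarieties] P. Deligne, *Variétés de Shimura*, PSPM XXXIII.2 (1979), 2.1.2, 2.2.5, Cor. 2.7.21
  (held: Milne's translation `paper:url-7710442a1cf6`, PDF pp. 23–24 (2.1.2–2.1.4), 29 (2.2.5), 51–52 (Cor. 2.7.21)).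
* [Milne2005ShimuraVarieties] J. S. Milne, *Introduction to Shimura varieties* (2005/2017, `paper:url-b0e8e4ca1c12`),
  Lemma 5.13 p. 57; Def. 12.8 (62) p. 114.
* [BergeronMillsonMoeglin2016Balls] N. Bergeron, J. Millson, C. Moeglin, Acta Math. 216 (2016), Introduction §1.1,
  Part 2 §§1.1–1.4 (the tree's `UnitaryBallUniformisationDatum`).
-/

set_option autoImplicit false

noncomputable section

open Function MulAction Topology NumberField IsDedekindDomain CategoryTheory AlgebraicGeometry Matrix
open scoped Matrix ComplexOrder
open Literature.AlgebraicGeometry.Motives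
open Literature.NumberTheory.Automorphic Literature.NumberTheory.Automorphic.UnitaryGroup
open Literature.NumberTheory.Automorphic.ShimuraDissection
open Literature.Geometry.ComplexHyperbolic Literature.Geometry.ComplexHyperbolic.BallModel

namespace Literature.AlgebraicGeometry.ShimuraVarieties

namespace UnitaryCanonicalModel

variable (L : Type) [Field L] [NumberField L] [IsCMField L] (H : Matrix (Fin 3) (Fin 3) L)
  (τ : L →+* ℂ) (T : GL (Fin 3) ℂ) (hT : formCongr (starRingEnd ℂ) T (H.map τ) = BallModel.J)
  (K : Subgroup (finAdelic (↥(maximalRealSubfield L)) L (IsCMField.complexConj L) 3 H))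

/-- **The complex record of `Sh_K(U(H), 𝔹²)`** — the complex-geometric clauses of Deligne's canonical-model record
`UnitaryCanonicalModel.Record L H τ T hT K` VERBATIM, stated for an arbitrary complex scheme `Mc` in place of the
complex fibre `M_τ = M ⊗_{L,τ} ℂ` ([Deligne1979ShimuraVarieties] 2.1.2: «`_K M_ℂ(G,X) = G(ℚ)\X × G(𝔸^f)/K` … is a
disjoint sum, indexed by the finite set `G(ℚ)\G(𝔸^f)/K`, of the quotients `Γ_g\X⁺` … [these] have the structure of a
quasi-projective algebraic variety [Baily–Borel] … unique [Borel]»; [Milne2005ShimuraVarieties] Lemma 5.13): (C1) `Mc` is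
smooth of relative dimension `2` and projective over `ℂ`; (C2a) `pts`: its complex points, with their analytic
topology, are `Sh_K(ℂ) = U(H)(L⁺) \ [𝔹² × U(H)(𝔸_{L⁺,f})/K]`; (C2b) `hol`: `z ↦ [z, aK]`, read on the negative cone of
`H^τ` through the frame `T`, is holomorphic in every algebraic coordinate of `Mc`; (C2c) `pieces`: `Mc` is a colimit
cofan, indexed by `Ξ_K` through representatives `g_q`, of compact ball quotients of the tree's kind
(`UnitaryBallUniformisationDatum 2`) with complex Gram matrix `H^τ`, group `τ(Γ_H(g_qKg_q⁻¹))` and uniformisation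
`z ↦ [z, g_qK]`.  No model over `L`, no Galois action, no reciprocity: the ARITHMETIC clauses of `Record` are exactly
what is omitted.  Nothing is asserted by the structure. [cite: Deligne1979ShimuraVarieties, 2.1.2 (PDF p. 24 L8–16 of Milne's translation)]
[cite: Milne2005ShimuraVarieties, Lemma 5.13 p. 57] [cite: BergeronMillsonMoeglin2016Balls, Introduction §1.1 and Part 2 §§1.1–1.4] -/
structure ComplexRecord where
  /-- (C1) the complex carrier. -/
  Mc : SchemeOver ℂ
  /-- (C1) `Mc → Spec ℂ` is smooth of relative dimension `2`. -/
  smooth : AlgebraicGeometry.SmoothOfRelativeDimension 2 Mc.hom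
  /-- (C1) `Mc` is projective over `ℂ`. -/
  projective : IsProjectiveOver Mc
  /-- (C2a) the complex points of `Mc`, with their analytic topology, are `Sh_K(ℂ)`. -/
  pts : ComplexPoints Mc ≃ₜ ShimuraSet L H τ T hT K
  /-- (C2b) for every `a ∈ U(H)(𝔸_{L⁺,f})`, `z ↦ [z, aK]` read on the negative cone of `H^τ` through the frame
  (`v = c · T·(z,1)`) is holomorphic in every algebraic coordinate of `Mc` (verbatim the clause
  `differentiableOn_unif` of the tree's `UnitaryBallUniformisationDatum`; `u` is meaningful on `negCone (H.map τ)`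
  only). -/
  hol : ∀ a : finAdelic (↥(maximalRealSubfield L)) L (IsCMField.complexConj L) 3 H,
      ∃ u : (Fin 3 → ℂ) → ComplexPoints Mc,
        (∀ x : Ball, u ((T : Matrix (Fin 3) (Fin 3) ℂ) *ᵥ BallModel.lift x) =
            pts.symm (ShimuraSet.mk L H τ T hT K x a)) ∧
        (∀ v ∈ negCone (H.map τ), ∀ c : ℂ, c ≠ 0 → u (c • v) = u v) ∧
        ∀ (U : Mc.left.affineOpens) (f : Mc.left.presheaf.obj (Opposite.op (↑U : Mc.left.Opens))),
          DifferentiableOn ℂ (fun v ↦ AlgPoints.evalOrZero (↑U : Mc.left.Opens) f (u v))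
            (negCone (H.map τ) ∩ u ⁻¹' {P | P.pt ∈ (↑U : Mc.left.Opens)})
  /-- (C2c) the PIECES: `Mc` is the finite coproduct (a colimit cofan in `SchemeOver ℂ`), indexed by `Ξ_K` through
  representatives `g_q`, of compact ball quotients of the tree's kind with complex Gram matrix `H^τ`, natural levels
  `τ(Γ_H(g_qKg_q⁻¹))` and uniformisation `z ↦ [z, g_qK]`. -/
  pieces : ∃ (g : orbitRel.Quotient (rational (↥(maximalRealSubfield L)) L (IsCMField.complexConj L) 3 H)
          (CosetSpace (rationalToFinAdelic (↥(maximalRealSubfield L)) L (IsCMField.complexConj L) 3 H) K) →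
        finAdelic (↥(maximalRealSubfield L)) L (IsCMField.complexConj L) 3 H)
      (_ : ∀ q, Quotient.mk'' (CosetSpace.pt (rationalToFinAdelic _ L _ 3 H) K (g q)) = q)
      (X : orbitRel.Quotient (rational (↥(maximalRealSubfield L)) L (IsCMField.complexConj L) 3 H)
          (CosetSpace (rationalToFinAdelic (↥(maximalRealSubfield L)) L (IsCMField.complexConj L) 3 H) K) →
        SchemeOver ℂ)
      (ι : ∀ q, X q ⟶ Mc)
      (_ : Limits.IsColimit (Limits.Cofan.mk Mc ι))
      (B : ∀ q, UnitaryBallUniformisationDatum 2 (X q)),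
      ∀ q, (B q).Hℂ = H.map τ ∧
        (B q).Γ.map (Matrix.GeneralLinearGroup.map ((B q).τ₁ : ↥(B q).E →+* ℂ)) =
          (arithmeticLevel (↥(maximalRealSubfield L)) L (IsCMField.complexConj L) 3 H
            (K.map (MulAut.conj (g q)).toMonoidHom)).map (Matrix.GeneralLinearGroup.map τ) ∧
        ∀ x : Ball, AlgPoints.map (ι q) ((B q).unif ((T : Matrix (Fin 3) (Fin 3) ℂ) *ᵥ BallModel.lift x)) =
          pts.symm (ShimuraSet.mk L H τ T hT K x (g q))

variable {L H τ T hT K}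

namespace Record

/-- **The complex shadow of a record** ([Deligne1979ShimuraVarieties] 2.2.5 «a form over `E(G,X)` of `M_ℂ(G,X)`»,
read backwards: the model determines the complex variety): `Mc := M_τ = M ⊗_{L,τ} ℂ`, (C1) by base change of (F1)
(tree `Record.smooth_complexFibre`, `Record.projective_complexFibre`), (C2a) = (F2a) composed with the homeomorphism
`M(ℂ)_{along τ} = M_τ(ℂ)` (tree `AlgPoints.baseChangeEquiv`, `AlgPoints.continuous_baseChangeEquiv(_symm)`), (C2b) =
(F2b) and (C2c) = (F2c) verbatim. [cite: Deligne1979ShimuraVarieties, 2.1.2 and 2.2.5] -/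
def complexRecord (R : Record L H τ T hT K) : ComplexRecord L H τ T hT K :=
  letI : Algebra L ℂ := τ.toAlgebra
  let b : ComplexPoints R.M ≃ₜ ComplexPoints ((Motives.baseChangeHom τ).obj R.M) :=
    Homeomorph.mk (AlgPoints.baseChangeEquiv τ R.M) (AlgPoints.continuous_baseChangeEquiv τ R.M)
      (AlgPoints.continuous_baseChangeEquiv_symm τ R.M)
  { Mc := (Motives.baseChangeHom τ).obj R.M
    smooth := R.smooth_complexFibre
    projective := R.projective_complexFibre
    pts := b.symm.trans R.pts
    hol := R.hol
    pieces := R.pieces }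

/-- The carrier of the shadow is the complex fibre `M_τ`. [cite: Deligne1979ShimuraVarieties, 2.2.5] -/
@[simp] theorem complexRecord_Mc (R : Record L H τ T hT K) :
    R.complexRecord.Mc = (Motives.baseChangeHom τ).obj R.M := rfl

/-- The points of the shadow are those of the record, read in `M_τ(ℂ)`:
`pts⁻¹ [z, aK] = AlgPoints.baseChangeEquiv τ M (R.pts⁻¹ [z, aK])`. [cite: Deligne1979ShimuraVarieties, 2.2.5] -/
theorem complexRecord_pts_symm_apply (R : Record L H τ T hT K) (P : ShimuraSet L H τ T hT K) :
    R.complexRecord.pts.symm P =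
      (letI : Algebra L ℂ := τ.toAlgebra
       AlgPoints.baseChangeEquiv τ R.M (R.pts.symm P)) := rfl

/-- **Every record has a complex shadow**: an inhabitant of `Record L H τ T hT K` yields one of
`ComplexRecord L H τ T hT K`. [cite: Deligne1979ShimuraVarieties, 2.1.2 and 2.2.5] -/
theorem nonempty_complexRecord (R : Record L H τ T hT K) : Nonempty (ComplexRecord L H τ T hT K) :=
  ⟨R.complexRecord⟩

end Record

/-- **The named fact yields complex records at every small level**: under `exists_recordSystem`, for `H` with a
frame at `τ`, definite off `τ`, anisotropic, and `K` compact open with torsion-free conjugate arithmetic levels,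
`ComplexRecord L H τ T hT K` is inhabited (the shadow of the record at the one-element system `K₀ := K`).
[cite: Deligne1979ShimuraVarieties, 2.2.5 and Cor. 2.7.21] -/
theorem nonempty_complexRecord_of_exists_recordSystem (h : exists_recordSystem)
    (hpos : ∀ τ' : L →+* ℂ, InfinitePlace.mk τ' ≠ InfinitePlace.mk τ → (H.map τ').PosDef)
    (hanis : ∀ v : Fin 3 → L, hermForm (cmConjRingHom L) H v v = 0 → v = 0)
    (hKo : IsOpen (K : Set (finAdelic (↥(maximalRealSubfield L)) L (IsCMField.complexConj L) 3 H)))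
    (hKc : IsCompact (K : Set (finAdelic (↥(maximalRealSubfield L)) L (IsCMField.complexConj L) 3 H)))
    (htf : ∀ g : finAdelic (↥(maximalRealSubfield L)) L (IsCMField.complexConj L) 3 H,
      ∀ γ ∈ arithmeticLevel (↥(maximalRealSubfield L)) L (IsCMField.complexConj L) 3 H
        (K.map (MulAut.conj g).toMonoidHom), IsOfFinOrder γ → γ = 1) :
    Nonempty (ComplexRecord L H τ T hT K) := by
  obtain ⟨R⟩ := exists_record h L H τ T hT hpos hanis K hKo hKc htf
  exact R.nonempty_complexRecord

end UnitaryCanonicalModel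

end Literature.AlgebraicGeometry.ShimuraVarieties

end
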